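import Summits.Ventures.Crystal3D.Bulk.HoleForm
import Literature.Geometry.DiscreteGeometry.KissingSearchFinal
import HarnessLib

/-!
# Bulk crystallization of sticky spheres modulo the certified angular gap alone (computational)

HONEST FRAMING. Part of the venture `Summits/Ventures/Crystal3D` (cell `pub-crystal3d`, phase 2),
companion of `Bulk/LocalTwelve.lean` (statement + reduction), `Bulk/LocalTwelveOfHales.lean`
(`L12Local` from `flyspeck_L12` + `Hales2012_kissingConfigCongruent`) and
`Bulk/TwelveNeighbourGap.lean` (the gap `TwelveNeighbourGap h₀` as the one remaining input). Here
the classification hypothesis `Hales2012_kissingConfigCongruent` is DISCHARGED by the tree's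
verified growth search over kissing configurations (`Hales2012_kissingConfigCongruent_holds`,
`Literature/Geometry/DiscreteGeometry/KissingSearchFinal.lean`: 128 `native_decide` parts), so the
theorems of this file depend on the axiom `Lean.ofReduceBool` (the native-decide axioms of that
run) in addition to the standard three — the file is COMPUTATIONAL in the gate's sense and kept
separate for exactly that reason.

RESULTS (each conditional on ONE named hypothesis, plus `Lean.ofReduceBool`):
* `bulkCrystallization3D_of_noHole' : NoHole 0.63 → BulkCrystallization3D 1296` — THE SPRINT'S
  END PRODUCT on this seat's lane: the engines' certified angular statement (AG) of
  `TARGET-GAP.md` §3 (typed as `NoHole 0.63` in `Bulk/HoleForm.lean`) ALONE implies that in every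
  contact-maximising packing of `N` unit balls in `ℝ³` all but `1296 · N^{2/3}` balls have an fcc
  or hcp contact shell; `l12Local_of_noHole'` likewise;
* `bulkCrystallization3D_of_flyspeck : flyspeck_L12 → BulkCrystallization3D 1296` — the same
  given Hales's Lemma 1 (`L12`, the local annulus inequality of *Dense Sphere Packings*,
  computer-assisted, formally verified in HOL Light) instead; `l12Local_of_flyspeck` likewise.
(The corollaries with `TwelveNeighbourGap hales_h0` / `GapTupleDiam` as the hypothesis, and the
sharper constant `702`, are the second typer's `Bulk/BulkOfGapComputational.lean`; not restated.)
NO unconditional crystallization theorem is claimed.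
-/

noncomputable section

namespace Summit.Ventures.Crystal3D

open Literature.Geometry.DiscreteGeometry

/-- **THE SPRINT'S END PRODUCT: bulk crystallization modulo the certified angular statement.**
`NoHole 0.63` — "no twelve unit vectors pairwise at inner product `≤ 1/2` admit a unit vector `p`
with all `⟪p, xᵢ⟫ ≤ 0.63`" (`TARGET-GAP.md` §3 (AG), what the two engine implementations certify)
— implies that in every contact-maximising packing of `N` unit balls in `ℝ³` all but
`1296 · N^{2/3}` balls have an fcc or hcp contact shell (computational: `Lean.ofReduceBool` through
the tree's kissing-configuration classification at `2h₀ = 2.52`). -/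
theorem bulkCrystallization3D_of_noHole' (hAG : NoHole 0.63) : BulkCrystallization3D 1296 :=
  bulkCrystallization3D_of_noHole_of_classification hAG Hales2012_kissingConfigCongruent_holds

/-- `L12(1)` modulo the certified angular statement (computational, as above). -/
theorem l12Local_of_noHole' (hAG : NoHole 0.63) : L12Local :=
  l12Local_of_noHole_of_classification hAG Hales2012_kissingConfigCongruent_holds

/-- **`L12(1)` modulo `flyspeck_L12`** (computational, as above). -/
theorem l12Local_of_flyspeck (hL12 : flyspeck_L12) : L12Local :=
  l12Local_of_hales hL12 Hales2012_kissingConfigCongruent_holds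

/-- **Bulk crystallization modulo `flyspeck_L12`**: Hales's Lemma 1 implies
`BulkCrystallization3D 1296` (computational, as above). -/
theorem bulkCrystallization3D_of_flyspeck (hL12 : flyspeck_L12) : BulkCrystallization3D 1296 :=
  bulkCrystallization3D_of_hales hL12 Hales2012_kissingConfigCongruent_holds

end Summit.Ventures.Crystal3D

end
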